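import Summits.BirchSwinnertonDyer.BirchSwinnertonDyer.Theorems.SignedLowerHalvesKobayashiLowerHalfLargeImageHorocycleMuFloor
import HarnessLib

/-!
# Route `SignedLowerHalves`, crux 3 `KobayashiLowerHalfLargeImage` (item stmt-BirchSwinnertonDyer-19001):
# line of record `kurihara_rigidity`, residue stub `stub_three` — READING: at `p = 3` the stub IS the `p`-inverted
# (rational) signed Eisenstein divisibility for both signs, modulo Mazur's Manin-constant fact `h3`; no μ-input,
# no (Conn), no B⁰ (cell `bsd-ssimc`, width seat `bsd-line-slh-p1-w2` gen 5, file 5; helper `--supports 19001`)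

HONEST FRAMING: the crux and `stub_three` are OPEN and nothing here proves them; BSD is not proved by any of this.
THEOREMS ONLY. CALIBRATION / SUPPORT (pen rule D34-4 (3)): this is NOT a proof of the registered stub — it takes the
λ-part as a displayed hypothesis — and never a `closes`.

`KuriharaRigidity.stub_three` (skeleton r2 b8007614) reads
`∀ W p, p = 3 → ClassX7 W p → ¬ W.HasCM → W.frobeniusTrace p = 0 → Surj W p → ∃ ε, KobayashiLowerDivisibility W p ε`.
By `HorocycleMuFloor.X7.exists_kobayashiLowerDivisibility_three_of_pInverted` (p648511: μ-floor at `3` INPUT-FREE —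
THEOREM B road on Vaserstein's theorem, slh-p3 / w6 —, `MuUpgrade` and `PeriodUnit` discharged, p647721) its conclusion
follows at every such pair from the `p`-INVERTED signed Eisenstein divisibility for both signs (the horocycle line's
`LambdaLowerDivisibility W 3 ε` body: `char X^ε = (g)`, `ι(3^m g) = ϖ · ι(L^ε_3 · h)`) and the period named fact
`h3 = realPeriodRat_eq_unit_mul_plusPeriod_three` (Mazur 1978 Cor. 4.1). So for the LEAD's ledger:
**`stub_three` ⟸ {rational ±-Eisenstein divisibility at `3` on X7 ∧ ¬CM ∧ `a₃ = 0` ∧ Surj, `h3`}** — the residue at `3`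
has NO μ-component left; what is missing is exactly a λ-part engine at `3` (Kim / Castella–Sano need `p > 3`; BSTW needs
semistability), the same object as the crux's hard stub read with `3` inverted.

References: [Kobayashi2003] Conjecture (p. 2); [Vaserstein1972SL2] Theorem; [Mazur1978] Cor. 4.1;
[GreenbergVatsal2000] §3 Remark 3.4; [PollackWeston2011] Thm. 4.1 (1), Rem. 4.2.
-/

set_option autoImplicit false
set_option linter.dupNamespace false

noncomputable section

open scoped Classical MatrixGroups ModularForm

open CongruenceSubgroup WeierstrassCurve Literature.NumberTheory.EllipticCurves
  Literature.NumberTheory.EllipticCurves.ModularForms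
  Literature.NumberTheory.EllipticCurves.Rank1Residual
  Literature.NumberTheory.EllipticCurves.Rank1Residual.Typed
  Literature.NumberTheory.EllipticCurves.Kobayashi2003 ZpExtension
  Summit.BirchSwinnertonDyer.Rank1Residual.Supersingular

namespace Summit.BirchSwinnertonDyer.BirchSwinnertonDyer.Theorems.HorocycleMuFloor

/-- **`KuriharaRigidity.stub_three` ⟸ {`p`-inverted signed Eisenstein divisibility at `3` for both signs on the stub's
class, `h3`}** — the stub's binder list and conclusion VERBATIM (`(p : ℕ) [Fact p.Prime]`, `p = 3 → …`), the λ-part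
displayed as the hypothesis `hlam` in the horocycle line's `LambdaLowerDivisibility` shape on the same class. The
μ-half, the μ-upgrade and the period unit are theorems (p648511 / p647721 / w6's p647857); `¬CM` and `Surj` are passed
to `hlam` only. CONDITIONAL on `hlam`, `h3`; not a proof of the stub. [cite: Kobayashi2003, Conjecture (p. 2)]
[cite: Vaserstein1972SL2, Theorem] [cite: Mazur1978, Cor. 4.1] [cite: GreenbergVatsal2000, §3, Remark 3.4] -/
theorem kuriharaRigidity_stub_three_of_pInverted (h3 : realPeriodRat_eq_unit_mul_plusPeriod_three)
    (hlam : ∀ (W : WeierstrassCurve ℚ) [W.IsElliptic] [W.IsGloballyMinimal] (p : ℕ) [Fact p.Prime],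
      p = 3 → ClassX7 W p → ¬ W.HasCM → W.frobeniusTrace p = 0 → Surj W p →
      ∀ (ε : ℤˣ) (κ : ZpExtension ℚ p) (γ : Field.absoluteGaloisGroup ℚ),
        κ.IsCyclotomic → κ.IsTopGenerator γ → IsCyclotomicVariable p γ →
      ∀ [NeZero (W.conductorNorm ℤ)] (f : CuspForm (Gamma0 (W.conductorNorm ℤ)) 2),
        IsNewformOf W f → ∀ (ϖ : ℚ), (ϖ : ℝ) * W.realPeriodRat = plusPeriod f →
      ∀ (Lplus Lminus : IwasawaAlgebra p), IsPollackPair f p Lplus Lminus →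
      ∀ (D : SignedSelmerDualData W κ γ ε),
        ∃ (g h : IwasawaAlgebra p) (m : ℕ), D.charIdeal = Ideal.span {g} ∧
          iwasawaToPowerSeries p (PowerSeries.C ((p : ℤ_[p]) ^ m) * g) =
            PowerSeries.C (ϖ : ℚ_[p]) * iwasawaToPowerSeries p (kobayashiL ε Lplus Lminus * h)) :
    ∀ (W : WeierstrassCurve ℚ) [W.IsElliptic] [W.IsGloballyMinimal] (p : ℕ) [Fact p.Prime],
      p = 3 → ClassX7 W p → ¬ W.HasCM → W.frobeniusTrace p = 0 → Surj W p →
      ∃ ε : ℤˣ, KobayashiLowerDivisibility W p ε := by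
  intro W _ _ p _ hp3 hX hCM hap hS
  have hlam' := hlam W p hp3 hX hCM hap hS
  subst hp3
  exact X7.exists_kobayashiLowerDivisibility_three_of_pInverted W h3 hX hap (by exact_mod_cast hlam')

/-- **The same reading per pair, class-free** (good reduction at `3` and `a₃ = 0` only; the λ-part for both signs at
the pair, `h3`): `∃ ε, KobayashiLowerDivisibility W 3 ε`. A restatement of
`exists_kobayashiLowerDivisibility_three_of_pInverted_of_good` in the stub's `(p : ℕ)`, `p = 3 →` binder shape, so that
X6 (semistable) consumers at `3` can cite it verbatim too. [cite: Kobayashi2003, Conjecture (p. 2)] [cite: Vaserstein1972SL2, Theorem] -/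
theorem exists_kobayashiLowerDivisibility_of_eq_three_of_pInverted (h3 : realPeriodRat_eq_unit_mul_plusPeriod_three)
    (W : WeierstrassCurve ℚ) [W.IsElliptic] [W.IsGloballyMinimal] (p : ℕ) [Fact p.Prime] (hp3 : p = 3)
    (hgood : W.HasGoodReductionAtPrime p) (hap : W.frobeniusTrace p = 0)
    (hlam : ∀ (ε : ℤˣ) (κ : ZpExtension ℚ p) (γ : Field.absoluteGaloisGroup ℚ),
        κ.IsCyclotomic → κ.IsTopGenerator γ → IsCyclotomicVariable p γ →
      ∀ [NeZero (W.conductorNorm ℤ)] (f : CuspForm (Gamma0 (W.conductorNorm ℤ)) 2),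
        IsNewformOf W f → ∀ (ϖ : ℚ), (ϖ : ℝ) * W.realPeriodRat = plusPeriod f →
      ∀ (Lplus Lminus : IwasawaAlgebra p), IsPollackPair f p Lplus Lminus →
      ∀ (D : SignedSelmerDualData W κ γ ε),
        ∃ (g h : IwasawaAlgebra p) (m : ℕ), D.charIdeal = Ideal.span {g} ∧
          iwasawaToPowerSeries p (PowerSeries.C ((p : ℤ_[p]) ^ m) * g) =
            PowerSeries.C (ϖ : ℚ_[p]) * iwasawaToPowerSeries p (kobayashiL ε Lplus Lminus * h)) :
    ∃ ε : ℤˣ, KobayashiLowerDivisibility W p ε := by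
  subst hp3
  exact exists_kobayashiLowerDivisibility_three_of_pInverted_of_good W h3 hgood hap (by exact_mod_cast hlam)

end Summit.BirchSwinnertonDyer.BirchSwinnertonDyer.Theorems.HorocycleMuFloor

end
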